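import Mathlib

/-!
# The single-Jordan-block principle along a reduced free fixed curve

Solo-blind programme on `ResolutionOfSingularities`, local theory at a `(ii₁)` point (paper §19.1,
Lemma Γ).  Let `σ` be an automorphism of order `p` of a regular local ring `B` of characteristic `p`
and `𝔮` a prime with `dim B/𝔮 = 1` along which the fixed scheme is generically reduced:
`I_σ B_𝔮 = 𝔮 B_𝔮`.  On `V := Ω_B ⊗ κ(𝔮)` the map `T := σ_lin - 1` is nilpotent, its image is the
conormal space `N* = 𝔮/𝔮² ⊗ κ(𝔮)` of codimension one, so `dim ker T = 1`; the lemma below then gives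
`ker T ≤ range T = N*`.  Since `d r ∈ ker T` for every invariant `r`, the restriction of an
invariant to the fixed curve has vanishing differential: `B^σ → κ(𝔮)` lands in `κ(𝔮)^p`
(the quotient map restricted to the curve is the Frobenius).  This file isolates the linear algebra.
-/

namespace Summit.ResolutionOfSingularities.ResolutionOfSingularities.Theorems.SoloBlind

open Module

variable {K V : Type*} [Field K] [AddCommGroup V] [Module K V]

/-- A nilpotent endomorphism of a nontrivial vector space has a nonzero kernel. -/
theorem ker_ne_bot_of_isNilpotent [Nontrivial V] {T : V →ₗ[K] V} (hT : IsNilpotent T) :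
    LinearMap.ker T ≠ ⊥ := by
  obtain ⟨n, hn⟩ := hT
  intro hbot
  have hinj : Function.Injective T := LinearMap.ker_eq_bot.mp hbot
  have hinjn : Function.Injective (T ^ n) := by
    rw [Module.End.coe_pow]
    exact Function.Injective.iterate hinj n
  obtain ⟨v, hv⟩ := exists_ne (0 : V)
  have h : (T ^ n) v = (T ^ n) 0 := by rw [hn]; simp
  exact hv (hinjn h)

/-- **Single Jordan block.**  If `T` is nilpotent with one-dimensional kernel on a space of
dimension at least `2`, then `ker T ≤ range T`. -/
theorem ker_le_range_of_isNilpotent_of_finrank_ker_eq_one [FiniteDimensional K V]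
    {T : V →ₗ[K] V} (hT : IsNilpotent T) (hker : finrank K (LinearMap.ker T) = 1)
    (hV : 2 ≤ finrank K V) : LinearMap.ker T ≤ LinearMap.range T := by
  have hinv : ∀ v ∈ LinearMap.range T, T v ∈ LinearMap.range T := fun v _ => ⟨v, rfl⟩
  -- the range is nontrivial, for otherwise `T = 0` and the kernel is everything
  have hr : Nontrivial (LinearMap.range T) := by
    rw [Submodule.nontrivial_iff_ne_bot]
    intro h0
    have hT0 : T = 0 := LinearMap.range_eq_bot.mp h0
    have htop : LinearMap.ker T = ⊤ := by rw [hT0]; exact LinearMap.ker_zero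
    rw [htop, finrank_top] at hker
    omega
  -- the restriction of `T` to its range is nilpotent, hence has a kernel vector
  have hres : IsNilpotent (T.restrict hinv) := by
    obtain ⟨n, hn⟩ := hT
    refine ⟨n, ?_⟩
    rw [Module.End.pow_restrict n]
    ext ⟨v, hv⟩
    simp [LinearMap.restrict_apply, hn]
  obtain ⟨u, hu, hu0⟩ := Submodule.exists_mem_ne_zero_of_ne_bot (ker_ne_bot_of_isNilpotent hres)
  have hTu : T (u : V) = 0 := by
    have h1 : T.restrict hinv u = 0 := LinearMap.mem_ker.mp hu
    have h2 := congrArg Subtype.val h1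
    simpa [LinearMap.restrict_apply] using h2
  have hu0' : (u : V) ≠ 0 := fun h => hu0 (Subtype.ext h)
  have hmemu : (u : V) ∈ LinearMap.ker T := LinearMap.mem_ker.mpr hTu
  -- the kernel is the line spanned by `u`, which lies in the range
  intro w hw
  have hne : (⟨(u : V), hmemu⟩ : LinearMap.ker T) ≠ 0 := by
    intro h; exact hu0' (congrArg Subtype.val h)
  obtain ⟨c, hc⟩ := (finrank_eq_one_iff_of_nonzero' _ hne).mp hker ⟨w, hw⟩
  have hc' : c • (u : V) = w := by simpa using congrArg Subtype.val hc
  rw [← hc']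
  exact Submodule.smul_mem _ c u.2

/-- **Lemma Γ, linear-algebra core.**  `T` nilpotent on `V`, with image a subspace `N` of
codimension one (`finrank V = finrank N + 1`, `N ≠ 0`): then `ker T ≤ N`.  (Applied with
`V = Ω ⊗ κ(𝔮)`, `N` = conormal space of the fixed curve, `T = σ_lin - 1`.) -/
theorem ker_le_of_isNilpotent_of_range_eq_hyperplane [FiniteDimensional K V]
    {T : V →ₗ[K] V} (hT : IsNilpotent T) {N : Submodule K V} (hrange : LinearMap.range T = N)
    (hdim : finrank K V = finrank K N + 1) (hN : 1 ≤ finrank K N) :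
    LinearMap.ker T ≤ N := by
  have hrn := LinearMap.finrank_range_add_finrank_ker T
  rw [hrange] at hrn
  have hker : finrank K (LinearMap.ker T) = 1 := by omega
  have hV : 2 ≤ finrank K V := by omega
  rw [← hrange]
  exact ker_le_range_of_isNilpotent_of_finrank_ker_eq_one hT hker hV

/-- Rank count used above: if the image of `T` is a hyperplane `N` (`finrank V = finrank N + 1`)
then the kernel of `T` is a line. -/
theorem finrank_ker_eq_one_of_range_eq_hyperplane [FiniteDimensional K V]
    {T : V →ₗ[K] V} {N : Submodule K V} (hrange : LinearMap.range T = N)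
    (hdim : finrank K V = finrank K N + 1) : finrank K (LinearMap.ker T) = 1 := by
  have hrn := LinearMap.finrank_range_add_finrank_ker T
  rw [hrange] at hrn
  omega

end Summit.ResolutionOfSingularities.ResolutionOfSingularities.Theorems.SoloBlind
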